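import Mathlib.Tactic
import Mathlib.Algebra.Order.Floor.Defs
import HarnessLib
import Summits.CriticalPhenomena.PercolationContinuityZ3.Theorems.PercNearOneGluingNoHeavyLowerTailQuantitativeAntitheticTowerChain

/-!
# The one-side calculus of the one-step induction (DC+) on the separator class (PROOFS §P72; BENCH M2-R113)

Support file (`--supports stmt-CriticalPhenomena-4575`), prover seat `prim-rate-mine-2` (lane prim-rate, constants-miner (c);
`run/shared/lean/prim/prim-rate/prim-rate-mine-2/PROOFS.md` §P72).  No definitions, no named facts, no sorries; standard axioms.

SETTING (PROOFS §P68 (h), §P71 (e),(h), §P72).  On a separator graph `G = S_L ∪ S_R` (`{x,a}` separates `b ∈ L` from `u ∈ R`) the antithetic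
functional is K5's bilinear form in the ANTITHETIC SIDE COUNTS `(λ̌, φ̌, ν)` of the two sides:
`Φ_C(G)/2 = (1+C)·Čov − φ̌_L φ̌_R`, `Čov = λ̌_R φ̌_L + λ̌_L φ̌_R + ν_L λ̌_R + λ̌_L ν_R − ν_L ν_R` — LINEAR in the `L`-counts for a fixed `R` side.
For a pair `e` of the `L` side the three graphs `G`, `G − e`, `G/e` are separator graphs with the SAME `R` side and `L` sides `H`, `H⁰ = H − e`,
`H¹ = H/e`, whose counts obey the ONE-PAIR IDENTITIES `λ̌ = λ̌⁰ + λ̌¹`, `φ̌ = φ̌⁰ + φ̌¹ + J_φ(e)` (`J_φ ≥ 0`: `A = [x↔a]`, `β = [b↔{x,a}]` are increasing),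
`ν = ν⁰ + ν¹ − J_ν(e)` (sign indefinite in general, `J_ν ≤ 0` at every spoke `{x,w}`).  Hence the (DC+) MARGIN of `e`,
`Φ_{C(n)}(G) − Φ_{C(n)}(G−e) − Φ_{C(n−1)}(G/e)`, is `2·[J_φ α_R − J_ν γ_R + Δ·Čov(H¹,R)]` with `α_R = (1+C)λ̌_R − φ̌_R`, `γ_R = (1+C)(λ̌_R − ν_R)`,
`Δ = C(n) − C(n−1)` — `CSH.sepMargin_identity` (pure algebra).  Consequences proved here:
* `CSH.sepMargin_spoke_nonneg` — ★ THIN OPPONENT: if `φ̌_R ≤ (1+C)λ̌_R` then every pair with `J_ν ≤ 0` (every spoke of the `L` side) satisfies (DC+).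
* `CSH.sepMargin_normalised` — with `(t,s) = (φ̌_R, ν_R)/λ̌_R` the margin is `2 λ̌_R · f_e(t,s)`,
  `f_e(t,s) = J_φ(1+C−t) − J_ν(1+C)(1−s) + Δ(φ̌¹ + tλ̌¹ + sλ̌¹ + (1−s)ν¹)` — the ABSTRACT-OPPONENT form of PROOFS §P72 (c) (conjecture (SD):
  every side other than a bare arm facing a longer one has, for every `(t,s) ∈ [0,r]×[0,1]`, a pair with `f_e ≥ 0`; verified for all sides with ≤ 4
  free vertices and every `r ≤ 8`).
* `CSH.sideDefence_trivialPair`, `CSH.sideDefence_smallJ` — the two unconditional winners (`J_φ = 0 ∧ J_ν ≤ 0`; `J_ν ≤ 0 ∧ J_φ ≤ Δλ̌¹`).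
* `CSH.sideDefence_arm` — the bare hub–path arm `P_k` (`(J_φ, J_ν, λ̌¹, φ̌¹, ν¹) = (1, 0, 1, k−1, 0)` at its end pair, PROOFS §P71 (h)) defends
  against every opponent with `t ≤ r ≤ k` (`K = k + r ≥ 5`): the tower-chain inequality in abstract form, from `CSH.sizeLawConst_recursion`.
* `CSH.dcplus_reducible_margin` — the margin of the trivially working pair of a REDUCIBLE instance (pendant / series non-terminal, leaf terminal):
  `Φ_c(H') − Φ_{c'}(H') = 2(c − c')·S(H') ≥ 0`.
[cite: VandenbergHaggstromKahn2005, Thm. 1.3 (p. 6)] [cite: Harris1960, Lemma 4.1 (p. 16)]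
-/

namespace Summit.CriticalPhenomena.PercolationContinuityZ3.Theorems.CSH

/-- **The one-side margin identity** (PROOFS §P72 (a)).  K5's antithetic bilinear form read on `G`, `G − e`, `G/e` (same `R` side; `L` sides
`H`, `H − e`, `H/e` with the one-pair identities `λ̌ = λ̌⁰+λ̌¹`, `φ̌ = φ̌⁰+φ̌¹+J_φ`, `ν = ν⁰+ν¹−J_ν`) gives
`margin/2 = J_φ·((1+c)λ̌_R − φ̌_R) − J_ν·(1+c)(λ̌_R − ν_R) + (c − c')·Čov(H/e, R)`. [cite: VandenbergHaggstromKahn2005, Thm. 1.3 (p. 6)] -/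
theorem sepMargin_identity (c c' lamR phiR nuR lam phi nu lam0 phi0 nu0 lam1 phi1 nu1 Jphi Jnu : ℚ)
    (hlam : lam = lam0 + lam1) (hphi : phi = phi0 + phi1 + Jphi) (hnu : nu = nu0 + nu1 - Jnu) :
    ((1 + c) * (lamR * phi + lam * phiR + nu * lamR + lam * nuR - nu * nuR) - phi * phiR)
      - ((1 + c) * (lamR * phi0 + lam0 * phiR + nu0 * lamR + lam0 * nuR - nu0 * nuR) - phi0 * phiR)
      - ((1 + c') * (lamR * phi1 + lam1 * phiR + nu1 * lamR + lam1 * nuR - nu1 * nuR) - phi1 * phiR)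
    = Jphi * ((1 + c) * lamR - phiR) - Jnu * ((1 + c) * (lamR - nuR))
      + (c - c') * (lamR * phi1 + lam1 * phiR + nu1 * lamR + lam1 * nuR - nu1 * nuR) := by
  subst hlam; subst hphi; subst hnu; ring

/-- **Thin opponent ⟹ every spoke works** (PROOFS §P72 (b)).  If the other side satisfies `φ̌_R ≤ (1+c)λ̌_R` (e.g. its `u`-component in `G − {x,a}`
has at most `1 + C(n)` vertices, by the component-size one-side lemma (aK4b′)), then every pair of the `L` side with `J_ν ≤ 0` — in particular
every spoke `{x,w}`, `w ∈ L` — has non-negative (DC+) margin: all three summands of `CSH.sepMargin_identity` are `≥ 0`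
(`J_φ ≥ 0` always; `ν ≤ λ̌` for every side; `c' = C(n−1) ≤ c = C(n)`; the counts of `H/e` are non-negative). [cite: Harris1960, Lemma 4.1 (p. 16)] -/
theorem sepMargin_spoke_nonneg (c c' lamR phiR nuR lam1 phi1 nu1 Jphi Jnu : ℚ)
    (hc : 0 ≤ 1 + c) (hcc : c' ≤ c) (hthin : phiR ≤ (1 + c) * lamR) (hnuR : nuR ≤ lamR) (hnuR0 : 0 ≤ nuR) (hphiR : 0 ≤ phiR)
    (hJphi : 0 ≤ Jphi) (hJnu : Jnu ≤ 0) (hlam1 : 0 ≤ lam1) (hphi1 : 0 ≤ phi1) (hnu1 : 0 ≤ nu1) :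
    0 ≤ Jphi * ((1 + c) * lamR - phiR) - Jnu * ((1 + c) * (lamR - nuR))
      + (c - c') * (lamR * phi1 + lam1 * phiR + nu1 * lamR + lam1 * nuR - nu1 * nuR) := by
  have hlamR : 0 ≤ lamR := le_trans hnuR0 hnuR
  have h1 : 0 ≤ Jphi * ((1 + c) * lamR - phiR) := mul_nonneg hJphi (by linarith)
  have h2 : 0 ≤ -Jnu * ((1 + c) * (lamR - nuR)) := mul_nonneg (by linarith) (mul_nonneg hc (by linarith))
  have hcov : 0 ≤ lamR * phi1 + lam1 * phiR + nu1 * lamR + lam1 * nuR - nu1 * nuR := by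
    have : lamR * phi1 + lam1 * phiR + nu1 * lamR + lam1 * nuR - nu1 * nuR
        = lamR * phi1 + lam1 * phiR + nu1 * (lamR - nuR) + lam1 * nuR := by ring
    rw [this]
    have := mul_nonneg hnu1 (sub_nonneg.mpr hnuR)
    positivity
  have h3 : 0 ≤ (c - c') * (lamR * phi1 + lam1 * phiR + nu1 * lamR + lam1 * nuR - nu1 * nuR) :=
    mul_nonneg (by linarith) hcov
  linarith

/-- **Normalised (abstract-opponent) form** (PROOFS §P72 (c)).  Writing the other side's counts as `φ̌_R = t·λ̌_R`, `ν_R = s·λ̌_R`, the margin of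
`CSH.sepMargin_identity` equals `λ̌_R · f_e(t,s)` with `f_e(t,s) = J_φ(1+c−t) − J_ν(1+c)(1−s) + Δ(φ̌¹ + tλ̌¹ + sλ̌¹ + (1−s)ν¹)`,
affine in `(t,s)`; the realised opponents lie in `[0, κ_R] × [0,1] ⊆ [0, r] × [0, 1]`. [cite: VandenbergHaggstromKahn2005, Thm. 1.3 (p. 6)] -/
theorem sepMargin_normalised (c Δ lamR phiR nuR t s lam1 phi1 nu1 Jphi Jnu : ℚ)
    (ht : phiR = t * lamR) (hs : nuR = s * lamR) :
    Jphi * ((1 + c) * lamR - phiR) - Jnu * ((1 + c) * (lamR - nuR))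
      + Δ * (lamR * phi1 + lam1 * phiR + nu1 * lamR + lam1 * nuR - nu1 * nuR)
    = lamR * (Jphi * (1 + c - t) - Jnu * ((1 + c) * (1 - s)) + Δ * (phi1 + t * lam1 + s * lam1 + (1 - s) * nu1)) := by
  subst ht; subst hs; ring

/-- **Trivial winner 1** (PROOFS §P72 (c)): a pair with `J_φ = 0` and `J_ν ≤ 0` defends against EVERY opponent `(t,s) ∈ [0,∞) × [0,1]`.
[cite: Harris1960, Lemma 4.1 (p. 16)] -/
theorem sideDefence_trivialPair (c Δ t s lam1 phi1 nu1 Jphi Jnu : ℚ)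
    (hc : 0 ≤ 1 + c) (hΔ : 0 ≤ Δ) (ht : 0 ≤ t) (hs0 : 0 ≤ s) (hs1 : s ≤ 1)
    (hJphi : Jphi = 0) (hJnu : Jnu ≤ 0) (hlam1 : 0 ≤ lam1) (hphi1 : 0 ≤ phi1) (hnu1 : 0 ≤ nu1) :
    0 ≤ Jphi * (1 + c - t) - Jnu * ((1 + c) * (1 - s)) + Δ * (phi1 + t * lam1 + s * lam1 + (1 - s) * nu1) := by
  subst hJphi
  have h2 : 0 ≤ -Jnu * ((1 + c) * (1 - s)) := mul_nonneg (by linarith) (mul_nonneg hc (by linarith))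
  have h3 : 0 ≤ Δ * (phi1 + t * lam1 + s * lam1 + (1 - s) * nu1) := by
    apply mul_nonneg hΔ
    have : 0 ≤ (1 - s) * nu1 := mul_nonneg (by linarith) hnu1
    positivity
  linarith

/-- **Trivial winner 2** (PROOFS §P72 (c)): a pair with `J_ν ≤ 0` and `0 ≤ J_φ ≤ Δ·λ̌(H/e)` defends against every opponent `(t,s) ∈ [0,∞) × [0,1]`
(the `t`-slope `Δλ̌¹ − J_φ` is non-negative). [cite: Harris1960, Lemma 4.1 (p. 16)] -/
theorem sideDefence_smallJ (c Δ t s lam1 phi1 nu1 Jphi Jnu : ℚ)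
    (hc : 0 ≤ 1 + c) (hΔ : 0 ≤ Δ) (ht : 0 ≤ t) (hs0 : 0 ≤ s) (hs1 : s ≤ 1)
    (hJphi : 0 ≤ Jphi) (hJsmall : Jphi ≤ Δ * lam1) (hJnu : Jnu ≤ 0) (hlam1 : 0 ≤ lam1) (hphi1 : 0 ≤ phi1) (hnu1 : 0 ≤ nu1) :
    0 ≤ Jphi * (1 + c - t) - Jnu * ((1 + c) * (1 - s)) + Δ * (phi1 + t * lam1 + s * lam1 + (1 - s) * nu1) := by
  have h2 : 0 ≤ -Jnu * ((1 + c) * (1 - s)) := mul_nonneg (by linarith) (mul_nonneg hc (by linarith))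
  have h4 : 0 ≤ t * (Δ * lam1 - Jphi) := mul_nonneg ht (by linarith)
  have h5 : 0 ≤ (1 - s) * nu1 := mul_nonneg (by linarith) hnu1
  have h6 : 0 ≤ Δ * (phi1 + s * lam1 + (1 - s) * nu1) := by apply mul_nonneg hΔ; positivity
  have h7 : 0 ≤ Jphi * (1 + c) := mul_nonneg hJphi hc
  nlinarith

/-- **The bare arm defends against every opponent that is not longer** (PROOFS §P72 (c); the abstract form of the tower-chain theorem
`CSH.towerChain_step_nonneg` / PROOFS §P71 (h)).  For the hub–path arm `P_k` at its end pair, `(J_φ, J_ν, λ̌¹, φ̌¹, ν¹) = (1, 0, 1, k−1, 0)`,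
so `f(t,s) = (1+c) + Δ(k−1) + t(Δ−1) + sΔ`; with `K = k + r ≥ 5`, `c = c K`, `Δ = c K − c(K−1)` and the recursion
`1 + c + Δ(K−1) = ⌊K/2⌋` (`CSH.sizeLawConst_recursion`): `f(t,s) ≥ ⌊K/2⌋ − r ≥ 0` for all `0 ≤ s`, `t ≤ r ≤ k`.
(For `r > k` it fails at `(t,s) = (r,0)`: the unbalanced tower peeled at its SHORT arm — the only exception to (SD) in all data.)
[cite: VandenbergHaggstromKahn2005, Thm. 1.3 (p. 6)] -/
theorem sideDefence_arm (K k r : ℕ) (hK : 5 ≤ K) (hsum : k + r = K) (hrk : r ≤ k) (t s : ℚ) (ht : t ≤ r) (hs : 0 ≤ s) :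
    0 ≤ 1 * (1 + ((((K ^ 2 / 4 : ℕ) : ℚ) / K - 1)) - t) - 0 * ((1 + ((((K ^ 2 / 4 : ℕ) : ℚ) / K - 1))) * (1 - s))
        + ((((K ^ 2 / 4 : ℕ) : ℚ) / K - 1) - ((((K - 1) ^ 2 / 4 : ℕ) : ℚ) / ((K - 1 : ℕ) : ℚ) - 1))
          * (((k : ℚ) - 1) + t * 1 + s * 1 + (1 - s) * 0) := by
  have hrec := sizeLawConst_recursion K hK
  obtain ⟨hΔ0, hΔ3⟩ := sizeLawConst_delta_lt_third K hK
  have hK1 : ((K - 1 : ℕ) : ℚ) = K - 1 := by rw [Nat.cast_sub (by omega : 1 ≤ K)]; push_cast; ring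
  rw [hK1] at hrec hΔ0 hΔ3 ⊢
  set c : ℚ := (((K ^ 2 / 4 : ℕ) : ℚ) / K - 1) with hc
  set Δ : ℚ := c - ((((K - 1) ^ 2 / 4 : ℕ) : ℚ) / ((K : ℚ) - 1) - 1) with hΔ
  have hfloor : (r : ℚ) ≤ ((K / 2 : ℕ) : ℚ) := by exact_mod_cast (show r ≤ K / 2 by omega)
  have hKq : (K : ℚ) = k + r := by rw [← hsum]; push_cast; ring
  have hrq : t * (Δ - 1) ≥ (r : ℚ) * (Δ - 1) := by nlinarith
  have hsΔ : 0 ≤ s * Δ := mul_nonneg hs hΔ0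
  -- f = (1 + c) + Δ(k-1) + t(Δ-1) + sΔ ≥ (1 + c + Δ(K-1)) - r + sΔ = ⌊K/2⌋ - r + sΔ ≥ 0
  nlinarith [hrec, hfloor, hrq, hsΔ, hKq]

/-- **Reducible instances carry a trivially working pair** (PROOFS §P72 (d)): for a pendant or series non-terminal vertex, a leaf terminal `b`, `u`
or `a`, the designated pair `e` has `Φₙ(G) − Φₙ(G−e) = Φₙ(H')` and `G/e = H'` for an explicit smaller graph `H'`, so the (DC+) margin is
`Φ_c(H') − Φ_{c'}(H') = 2(c − c')·S(H') ≥ 0` (`Φ_c = 2(C₀ + c·S)`, `S ≥ 0` by Harris, `c' = C(n−1) ≤ c = C(n)`).  Hence (DC+) needs proof only on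
REDUCED instances (all non-terminal degrees ≥ 3, `deg a, deg b, deg u ≥ 2`). [cite: Harris1960, Lemma 4.1 (p. 16)] -/
theorem dcplus_reducible_margin (ΦG ΦGe C0 S c c' : ℚ) (hdiff : ΦG - ΦGe = 2 * (C0 + c * S)) (hS : 0 ≤ S) (hcc : c' ≤ c) :
    0 ≤ ΦG - ΦGe - 2 * (C0 + c' * S) := by
  rw [hdiff]; nlinarith

end Summit.CriticalPhenomena.PercolationContinuityZ3.Theorems.CSH
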